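import Summits.HubbardSuperconductivity.HubbardSuperconductivity.Theorems.WeakCouplingBCSKlLindhardEnclosureSameSide
import Literature.MathematicalPhysics.QuantumLattice.KohnLuttingerLindhardMeasurable

/-!
# KL-MARGIN-SCAN reader (22) «kernel-lindhard-enclosure» — the CRUDE ceiling rule DISCHARGED

Second of the seven rule-level debts paid in full: `CeilCrudeSoundOrd P` holds for EVERY parameter record `P`.  Content: on a guarded,
oriented cell inside the root square the certified distance floors are sound (`distLoZ/2^40 ≤ |ε − μ|` at `p` and at `p + q`, from
`…CellSound`), so the two-shell integrand obeys `F ≤ 1/(|ε_p − μ| + |ε_{p+q} − μ|) ≤ 2^40/L` (`Literature…lindhardIntegrand_le_inv`) with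
`L = distLoZ(e1) + distLoZ(e2) > 0`; the cell `[a/U, b/U) × [c/U, d/U)` has Lebesgue measure `(b−a)(d−c)/U²` (pulled back through
`PiLp.volume_preserving_ofLp`, `Real.volume_pi_Ico`); hence `F` is integrable on the cell and `2^30 ∫_cell F ≤ 2^30·2^40·(b−a)(d−c)/(U²L) ≤
cdivZ (2^30 (b−a)(d−c) 2^40) (U² L)` = the kernel's crude numerator.  With `…SameSide`, the remaining CEILING debt of `CeilSoundAt P t` (all
trees) is exactly the three rules chord / majorised hyperbola / tip (`ceilSoundAt_of_three_rules`).  Honest framing: nothing in this file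
asserts a KL margin at any `t′ ≠ 0`, `K₃`, `U₀`, the window or B1g dominance; a Kohn–Luttinger instability statement is not ODLRO and
nothing here proves superconductivity in the Hubbard model.  (p1 g25, 2026-08-29.)
-/

noncomputable section

set_option linter.dupNamespace false

namespace Summit.HubbardSuperconductivity.HubbardSuperconductivity.Theorems.KlLindhardEnclosure

open Real Set MeasureTheory Literature.MathematicalPhysics.QuantumLattice
open Summit.HubbardSuperconductivity.HubbardSuperconductivity.Theorems

/-! ## §1 The certified distance floors are sound -/

/-- `muFl ≤ 2^40 μ`. -/
theorem Params.muFl_le (P : Params) (hmuD : 0 < P.muD) : (P.muFl : ℝ) ≤ 2 ^ 40 * ((P.mu : ℚ) : ℝ) := by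
  have h := fdivZ_le_div (P.muN * D) P.muD hmuD
  have h' := (Rat.cast_le (K := ℝ)).mpr h
  have hmuD' : (0 : ℝ) < (P.muD : ℝ) := by exact_mod_cast hmuD
  simp only [Params.muFl] at h' ⊢
  rw [P.cast_mu]
  have e : ((((P.muN * D : ℤ) : ℚ) / ((P.muD : ℤ) : ℚ) : ℚ) : ℝ) = 2 ^ 40 * ((P.muN : ℝ) / (P.muD : ℝ)) := by
    push_cast [D]; field_simp; norm_num
  rw [e] at h'
  exact_mod_cast h'

/-- `2^40 μ ≤ muCl`. -/
theorem Params.le_muCl (P : Params) (hmuD : 0 < P.muD) : 2 ^ 40 * ((P.mu : ℚ) : ℝ) ≤ (P.muCl : ℝ) := by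
  have h := div_le_cdivZ (P.muN * D) P.muD hmuD
  have h' := (Rat.cast_le (K := ℝ)).mpr h
  have hmuD' : (0 : ℝ) < (P.muD : ℝ) := by exact_mod_cast hmuD
  simp only [Params.muCl] at h' ⊢
  rw [P.cast_mu]
  have e : ((((P.muN * D : ℤ) : ℚ) / ((P.muD : ℤ) : ℚ) : ℚ) : ℝ) = 2 ^ 40 * ((P.muN : ℝ) / (P.muD : ℝ)) := by
    push_cast [D]; field_simp; norm_num
  rw [e] at h'
  exact_mod_cast h'

/-- **DISTANCE FLOOR SOUNDNESS**: for an energy `e ∈ [eLo, eHi]/2^40`, `distLoZ eLo eHi / 2^40 ≤ |e − μ|`. -/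
theorem Params.distLoZ_le (P : Params) (hmuD : 0 < P.muD) {eLo eHi : ℤ} {e : ℝ} (hlo : ((eLo : ℤ) : ℝ) / 2 ^ 40 ≤ e)
    (hhi : e ≤ ((eHi : ℤ) : ℝ) / 2 ^ 40) : ((P.distLoZ eLo eHi : ℤ) : ℝ) / 2 ^ 40 ≤ |e - ((P.mu : ℚ) : ℝ)| := by
  have hF := P.muFl_le hmuD
  have hC := P.le_muCl hmuD
  rcases hs : P.status eLo eHi with _ | ⟨_ | _⟩
  · simp [Params.distLoZ, hs]
  · -- some false: μ ≤ eLo/2^40 ≤ e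
    have hμ := P.status_false_le hmuD hs
    simp only [Params.distLoZ, hs, Int.cast_max, Int.cast_zero, Int.cast_sub]
    rw [div_le_iff₀ (by positivity)]
    apply max_le
    · positivity
    · have : e - ((P.mu : ℚ) : ℝ) ≤ |e - ((P.mu : ℚ) : ℝ)| := le_abs_self _
      have h2 : ((eLo : ℤ) : ℝ) ≤ 2 ^ 40 * e := by rw [div_le_iff₀ (by positivity)] at hlo; linarith
      nlinarith
  · -- some true: e ≤ eHi/2^40 < μ
    have hμ := P.status_true_lt hmuD hs
    simp only [Params.distLoZ, hs, Int.cast_max, Int.cast_zero, Int.cast_sub]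
    rw [div_le_iff₀ (by positivity)]
    apply max_le
    · positivity
    · have : ((P.mu : ℚ) : ℝ) - e ≤ |e - ((P.mu : ℚ) : ℝ)| := by rw [abs_sub_comm]; exact le_abs_self _
      have h2 : 2 ^ 40 * e ≤ ((eHi : ℤ) : ℝ) := by rw [le_div_iff₀ (by positivity)] at hhi; linarith
      nlinarith

/-! ## §2 The measure of a grid cell -/

/-- A grid cell as the preimage of a coordinate box under `ofLp`. -/
theorem Params.cellSet_eq_preimage (P : Params) (a b c d : ℤ) :
    P.cellSet a b c d = (WithLp.ofLp : Momentum → (Fin 2 → ℝ)) ⁻¹'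
      Set.pi Set.univ (fun i => Ico ((![((P.toQ a : ℚ) : ℝ), ((P.toQ c : ℚ) : ℝ)] : Fin 2 → ℝ) i)
        ((![((P.toQ b : ℚ) : ℝ), ((P.toQ d : ℚ) : ℝ)] : Fin 2 → ℝ) i)) := by
  ext p
  simp only [Params.cellSet, mem_setOf_eq, mem_preimage, mem_pi, mem_univ, true_implies, Fin.forall_fin_two, mem_Ico,
    Matrix.cons_val_zero, Matrix.cons_val_one]
  constructor
  · rintro ⟨h1, h2, h3, h4⟩; exact ⟨⟨h1, h2⟩, ⟨h3, h4⟩⟩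
  · rintro ⟨⟨h1, h2⟩, ⟨h3, h4⟩⟩; exact ⟨h1, h2, h3, h4⟩

/-- **THE MEASURE OF A GRID CELL**: `vol [a/U, b/U) × [c/U, d/U) = (b/U − a/U)₊ · (d/U − c/U)₊`. -/
theorem Params.volume_cellSet (P : Params) (a b c d : ℤ) :
    volume (P.cellSet a b c d) = ENNReal.ofReal (((P.toQ b : ℚ) : ℝ) - ((P.toQ a : ℚ) : ℝ)) *
      ENNReal.ofReal (((P.toQ d : ℚ) : ℝ) - ((P.toQ c : ℚ) : ℝ)) := by
  rw [P.cellSet_eq_preimage, (PiLp.volume_preserving_ofLp (Fin 2)).measure_preimage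
    (MeasurableSet.univ_pi fun _ => measurableSet_Ico).nullMeasurableSet, Real.volume_pi_Ico]
  simp [Fin.prod_univ_two]

/-- The measure of a grid cell is finite. -/
theorem Params.volume_cellSet_lt_top (P : Params) (a b c d : ℤ) : volume (P.cellSet a b c d) < ⊤ := by
  rw [P.volume_cellSet]
  exact ENNReal.mul_lt_top ENNReal.ofReal_lt_top ENNReal.ofReal_lt_top

/-- The real measure of an ORIENTED grid cell: `(b−a)(d−c)/U²`. -/
theorem Params.volumeReal_cellSet (P : Params) (hU : 0 < P.U) {a b c d : ℤ} (hab : a ≤ b) (hcd : c ≤ d) :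
    volume.real (P.cellSet a b c d) = ((b : ℝ) - (a : ℝ)) * ((d : ℝ) - (c : ℝ)) / ((P.U : ℝ) ^ 2) := by
  have hU' : (0 : ℝ) < (P.U : ℝ) := by exact_mod_cast hU
  have e1 : ((P.toQ b : ℚ) : ℝ) - ((P.toQ a : ℚ) : ℝ) = ((b : ℝ) - (a : ℝ)) / (P.U : ℝ) := by
    rw [P.cast_toQ, P.cast_toQ]; ring
  have e2 : ((P.toQ d : ℚ) : ℝ) - ((P.toQ c : ℚ) : ℝ) = ((d : ℝ) - (c : ℝ)) / (P.U : ℝ) := by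
    rw [P.cast_toQ, P.cast_toQ]; ring
  have h1 : (0 : ℝ) ≤ ((b : ℝ) - (a : ℝ)) / (P.U : ℝ) := div_nonneg (by exact_mod_cast sub_nonneg.mpr hab) hU'.le
  have h2 : (0 : ℝ) ≤ ((d : ℝ) - (c : ℝ)) / (P.U : ℝ) := div_nonneg (by exact_mod_cast sub_nonneg.mpr hcd) hU'.le
  rw [Measure.real, P.volume_cellSet, e1, e2, ENNReal.toReal_mul, ENNReal.toReal_ofReal h1, ENNReal.toReal_ofReal h2]
  field_simp

/-! ## §3 The crude rule -/

/-- The band of the certificate is measurable. -/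
theorem Params.measurable_band (P : Params) : Measurable P.band := by
  have : Continuous P.band := by unfold Params.band squareDispersion; fun_prop
  exact this.measurable

/-- The two-shell integrand of the certificate is measurable. -/
theorem Params.measurable_integrand (P : Params) : Measurable P.integrand :=
  measurable_lindhardIntegrand P.measurable_band _ _

/-- **POINTWISE CRUDE BOUND**: on a guarded oriented cell inside the root square with `L = distLoZ(e1) + distLoZ(e2) > 0`,
`F(p) ≤ 2^40 / L`. -/
theorem Params.integrand_le_crude (P : Params) (hP : P.admissible = true) {a b c d : ℤ} (hin : P.InRoot a b c d)
    (hg : (P.cell (P.mkX a) (P.mkX b) (P.mkY c) (P.mkY d)).guards = true)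
    (hL : 0 < P.distLoZ (P.cell (P.mkX a) (P.mkX b) (P.mkY c) (P.mkY d)).e1Lo (P.cell (P.mkX a) (P.mkX b) (P.mkY c) (P.mkY d)).e1Hi +
      P.distLoZ (P.cell (P.mkX a) (P.mkX b) (P.mkY c) (P.mkY d)).e2Lo (P.cell (P.mkX a) (P.mkX b) (P.mkY c) (P.mkY d)).e2Hi)
    {p : Momentum} (hp : p ∈ P.cellSet a b c d) :
    P.integrand p ≤ 2 ^ 40 / (((P.distLoZ (P.cell (P.mkX a) (P.mkX b) (P.mkY c) (P.mkY d)).e1Lo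
      (P.cell (P.mkX a) (P.mkX b) (P.mkY c) (P.mkY d)).e1Hi +
      P.distLoZ (P.cell (P.mkX a) (P.mkX b) (P.mkY c) (P.mkY d)).e2Lo (P.cell (P.mkX a) (P.mkX b) (P.mkY c) (P.mkY d)).e2Hi : ℤ) : ℝ)) := by
  obtain ⟨-, hmuD, -, -, -⟩ := P.admissible_facts hP
  obtain ⟨ha, -, -, hb, hc, -, -, hd⟩ := hin
  obtain ⟨e1l, e1h⟩ := P.cell_band_mem hP ha hb hc hd hg hp
  obtain ⟨e2l, e2h⟩ := P.cell_band_shift_mem hP ha hb hc hd hg hp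
  have d1 := P.distLoZ_le hmuD e1l e1h
  have d2 := P.distLoZ_le hmuD e2l e2h
  have hL' : (0 : ℝ) < ((P.distLoZ (P.cell (P.mkX a) (P.mkX b) (P.mkY c) (P.mkY d)).e1Lo
      (P.cell (P.mkX a) (P.mkX b) (P.mkY c) (P.mkY d)).e1Hi +
      P.distLoZ (P.cell (P.mkX a) (P.mkX b) (P.mkY c) (P.mkY d)).e2Lo (P.cell (P.mkX a) (P.mkX b) (P.mkY c) (P.mkY d)).e2Hi : ℤ) : ℝ) := by
    exact_mod_cast hL
  have hF := lindhardIntegrand_le_inv P.band ((P.mu : ℚ) : ℝ) P.qv p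
  have hsum : ((P.distLoZ (P.cell (P.mkX a) (P.mkX b) (P.mkY c) (P.mkY d)).e1Lo
      (P.cell (P.mkX a) (P.mkX b) (P.mkY c) (P.mkY d)).e1Hi +
      P.distLoZ (P.cell (P.mkX a) (P.mkX b) (P.mkY c) (P.mkY d)).e2Lo (P.cell (P.mkX a) (P.mkX b) (P.mkY c) (P.mkY d)).e2Hi : ℤ) : ℝ) / 2 ^ 40
      ≤ |P.band p - ((P.mu : ℚ) : ℝ)| + |P.band (p + P.qv) - ((P.mu : ℚ) : ℝ)| := by
    push_cast at d1 d2 ⊢; rw [add_div]; exact add_le_add d1 d2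
  calc P.integrand p = lindhardIntegrand P.band ((P.mu : ℚ) : ℝ) P.qv p := rfl
    _ ≤ 1 / (|P.band p - ((P.mu : ℚ) : ℝ)| + |P.band (p + P.qv) - ((P.mu : ℚ) : ℝ)|) := hF
    _ ≤ 1 / ((((P.distLoZ (P.cell (P.mkX a) (P.mkX b) (P.mkY c) (P.mkY d)).e1Lo
      (P.cell (P.mkX a) (P.mkX b) (P.mkY c) (P.mkY d)).e1Hi +
      P.distLoZ (P.cell (P.mkX a) (P.mkX b) (P.mkY c) (P.mkY d)).e2Lo (P.cell (P.mkX a) (P.mkX b) (P.mkY c) (P.mkY d)).e2Hi : ℤ) : ℝ)) / 2 ^ 40) :=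
        one_div_le_one_div_of_le (by positivity) hsum
    _ = _ := by rw [one_div_div]

/-- **THE CRUDE RULE HOLDS for every `P`.** -/
theorem ceilCrudeSoundOrd (P : Params) : CeilCrudeSoundOrd P := by
  intro a b c d v hP hin hab hcd hg hv
  obtain ⟨-, hmuD, hU, -, -⟩ := P.admissible_facts hP
  have hU' : (0 : ℝ) < (P.U : ℝ) := by exact_mod_cast hU
  -- open the kernel's crude rule
  simp only [Params.ceilCrude, Params.mkX_z, Params.mkY_z] at hv
  split_ifs at hv with hL
  simp only [Option.some.injEq] at hv
  set L := P.distLoZ (P.cell (P.mkX a) (P.mkX b) (P.mkY c) (P.mkY d)).e1Lo (P.cell (P.mkX a) (P.mkX b) (P.mkY c) (P.mkY d)).e1Hi +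
      P.distLoZ (P.cell (P.mkX a) (P.mkX b) (P.mkY c) (P.mkY d)).e2Lo (P.cell (P.mkX a) (P.mkX b) (P.mkY c) (P.mkY d)).e2Hi with hLdef
  have hL' : (0 : ℝ) < (L : ℝ) := by exact_mod_cast hL
  -- pointwise bound and measurability ⇒ integrable; integral ≤ const · volume
  have hbd : ∀ p ∈ P.cellSet a b c d, ‖P.integrand p‖ ≤ 2 ^ 40 / (L : ℝ) := by
    intro p hp
    rw [Real.norm_of_nonneg (P.integrand_nonneg p)]
    exact P.integrand_le_crude hP hin hg hL hp
  have hmeas := P.measurableSet_cellSet a b c d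
  have hvol := P.volume_cellSet_lt_top a b c d
  have hint : IntegrableOn P.integrand (P.cellSet a b c d) volume :=
    Measure.integrableOn_of_bounded hvol.ne P.measurable_integrand.aestronglyMeasurable
      (ae_restrict_of_forall_mem hmeas hbd)
  refine ⟨hint, ?_⟩
  have hI : ‖∫ p in P.cellSet a b c d, P.integrand p‖ ≤ 2 ^ 40 / (L : ℝ) * volume.real (P.cellSet a b c d) :=
    norm_setIntegral_le_of_norm_le_const hvol hbd
  rw [Real.norm_of_nonneg (setIntegral_nonneg hmeas fun p _ => P.integrand_nonneg p), P.volumeReal_cellSet hU hab hcd] at hI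
  -- the integer rounding of the kernel
  have hden : 0 < P.U ^ 2 * L := by positivity
  have rc : ((2 ^ 30 * (b - a) * (d - c) * D : ℤ) : ℝ) / ((P.U ^ 2 * L : ℤ) : ℝ) ≤ ((cdivZ (2 ^ 30 * (b - a) * (d - c) * D) (P.U ^ 2 * L) : ℤ) : ℝ) := by
    have h := div_le_cdivZ (2 ^ 30 * (b - a) * (d - c) * D) (P.U ^ 2 * L) hden
    have := (Rat.cast_le (K := ℝ)).mpr h
    simpa [Rat.cast_div] using this
  rw [← hv]
  refine le_trans ?_ rc
  unfold Params.cellInt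
  push_cast [D]
  rw [le_div_iff₀ (by positivity)]
  have key : 2 ^ 30 * (∫ p in P.cellSet a b c d, P.integrand p) * ((P.U : ℝ) ^ 2 * (L : ℝ))
      ≤ 2 ^ 30 * (2 ^ 40 / (L : ℝ) * (((b : ℝ) - (a : ℝ)) * ((d : ℝ) - (c : ℝ)) / (P.U : ℝ) ^ 2)) * ((P.U : ℝ) ^ 2 * (L : ℝ)) :=
    mul_le_mul_of_nonneg_right (mul_le_mul_of_nonneg_left hI (by positivity)) (by positivity)
  have e : 2 ^ 30 * (2 ^ 40 / (L : ℝ) * (((b : ℝ) - (a : ℝ)) * ((d : ℝ) - (c : ℝ)) / (P.U : ℝ) ^ 2)) * ((P.U : ℝ) ^ 2 * (L : ℝ))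
      = 2 ^ 30 * ((b : ℝ) - (a : ℝ)) * ((d : ℝ) - (c : ℝ)) * 2 ^ 40 := by
    field_simp
  linarith [key, e.le, e.ge]

/-- **CEILING SOUNDNESS FROM THE THREE REMAINING RULES** (chord, majorised hyperbola, tip), for every certificate tree. -/
theorem ceilSoundAt_of_three_rules (P : Params) (hCh : CeilChordSoundOrd P) (hB : CeilBdrySoundOrd P) (hT : CeilTipSoundOrd P)
    (t : QB) : CeilSoundAt P t :=
  ceilSoundAt_of_four_rules P (ceilCrudeSoundOrd P) hCh hB hT t

end Summit.HubbardSuperconductivity.HubbardSuperconductivity.Theorems.KlLindhardEnclosure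

end
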